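import Summits.KontsevichZagierPeriods.Zeta5Search.Barrier.ConeGammaCritFarNear

/-!
# ζ(5) search — BARRIER: THE FAR CRITICAL POINT THROUGH INFINITY — the certificate theorems (`C₀`, `C₁` and `γ` on a
# box from `critFarCheck`, under `Regular`; across the degenerate-resultant stratum)

HONEST FRAMING (cell `pub-zeta5`): systematic search; no irrationality claim unless kernel-certified. MODEL objects under
Brown–Zudilin's (28)+(30) accounting ([BZ22] = arXiv:2210.03391; (28) observed, not proved): the critical values
`C₀`, `C₁`, the rate `γ = gamma` of `ConeGammaRates`. This file turns cert-2 g38's computable checker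
(`ConeGammaCritFar.critFarCheck`) into theorems; nothing here moves any number of record, and nothing is said about
the cone's supremum (C2 = `BarrierC2`, OPEN), S-E (CONJECTURED), (TD_A) or `ζ(5)`. Theory seat cert-2 g38.

THE LOGICAL FORM (new). For a direction `t` of the box (normalised, `t₀ = 1`) ASSUME `Regular (aOfS t)` (three
critical values — exactly the guard of `ConeSupBound`). The checker certifies: two near critical points (g37's
Poincaré–Miranda boxes) with `|Y| ≤ M`, values `v₀ ∈ [l₀,h₀]`, `v₂ ∈ [l₂,h₂]`; a zero `z₁ ∈ (z⁻,z⁺)` of the reversed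
cubic (`exists_revC_zero`), which under `Regular` is non-zero (`root_of_revC_zero`: `z₁ = 0` would put `t` on the
stratum `{a₃ = 0}`, where at most two critical values exist), so `Y₁ = 1/z₁` is a third root with `|Y₁| > 1/|z|ₘₐₓ
> M`; three distinct roots exhaust the cubic (`cubicFun_roots_finite`), so by P2 g23's `critVals_aOfS_eq_image` the
critical values are `{v₀, v₁, v₂}` with `v₁` = the far value, enclosed over box × piece by `farValueAF_sound` +
`growthLogR_far`; with `h₀, h₁ < l₂`: **`C₁ = v₂ ≤ c₁⁺` and `c₀⁻ ≤ v₁ ≤ C₀ = max(v₀,v₁) ≤ c₀⁺`**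
(`bounds_aOfS_of_critFarCheck`). Homogeneity transfers this to every `a` of the closed positive box whose normalised
parameters lie in the box (`bounds_of_critFarCheck`, `C1_le_of_critFarCheck`, `C0_mem_of_critFarCheck`); the
assembled `γ`-bound is `ConeGammaCritFarGamma.gamma_le_of_critFarCheck`.
-/

noncomputable section

open Set

namespace Summit.KontsevichZagierPeriods.Zeta5Search.Barrier.ConeGamma

namespace CritFar

open Literature.Analysis.ValidatedNumerics (AForm)
open Literature.Analysis.ValidatedNumerics.AForm
open LemmaFBox (SC SC_pos)
open CritBox

/-! ### Identification under `Regular` -/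

/-- **The critical values of a REGULAR box direction, from `critFarCheck`**: `C₁ ≤ c₁⁺`, `c₀⁻ ≤ C₀ ≤ c₀⁺` (per unit
`s₀`, at the normalised direction `t`, `t₀ = 1`). -/
theorem bounds_aOfS_of_critFarCheck {D T : ℕ} {lo hi : List ℕ} {r0 r2 : RootData} {fd : FarData}
    {c0lo c0hi c1hi : ℤ} {den : ℕ} (hc : critFarCheck D T lo hi r0 r2 fd c0lo c0hi c1hi den = true)
    {t : Fin 8 → ℝ} (h : t ∈ LemmaFBox.box D lo hi) (ht0 : t 0 = 1) (hreg : Regular (aOfS t)) :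
    C1 (aOfS t) ≤ (c1hi : ℝ) / den ∧ (c0lo : ℝ) / den ≤ C0 (aOfS t) ∧ C0 (aOfS t) ≤ (c0hi : ℝ) / den ∧
      C0 (aOfS t) < C1 (aOfS t) := by
  -- unpack the checker
  unfold critFarCheck at hc
  split at hc
  · rename_i h0 l1 h1 l2 h2 hr0 hfc hr2
    simp only [Bool.and_eq_true, decide_eq_true_eq, nearSep] at hc
    obtain ⟨⟨⟨hok, hsep0⟩, hsep2⟩, hT, hden, hfar0, hfar2, hlen0, hlen2, h02, h12, hC1, hC0lo, hC0hi⟩ := hc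
    have hD : 0 < D := by
      have := hok; simp only [boxOKc, decide_eq_true_eq] at this; exact this.1
    have hopen := openBox_of_box hok h ht0
    have h6 := hopen 5
    change 0 < t 6 ∧ t 6 < t 0 at h6
    have hSC : (0 : ℝ) < SC := by exact_mod_cast SC_pos
    have hden' : (0 : ℝ) < den := by exact_mod_cast hden
    set Qn : ℕ := 2 * D * T with hQn
    have hQ : 0 < Qn := by rw [hQn]; exact Nat.mul_pos (Nat.mul_pos (by norm_num) hD) hT
    have hQr : (0 : ℝ) < Qn := by exact_mod_cast hQ
    -- the two near critical points
    obtain ⟨X0, Y0, hk0, hl0, hu0, hloc0⟩ := exists_near_of_rootCheck hok hT h ht0 hfar0 hlen0 hr0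
    obtain ⟨X2, Y2, hk2, hl2, hu2, hloc2⟩ := exists_near_of_rootCheck hok hT h ht0 hfar2 hlen2 hr2
    clear hr0 hr2
    -- unpack the far check; use the sign change at once and CLEAR the checker hypotheses
    unfold farCheck at hfc
    split at hfc
    swap
    · exact absurd hfc (by simp)
    rename_i hfcond
    obtain ⟨⟨hzden, hzlt, hzlo, hzhi, hpieces, hsg⟩, hall⟩ := hfcond
    simp only [Option.some.injEq, Prod.mk.injEq] at hfc
    obtain ⟨hl1, hh1v⟩ := hfc
    obtain ⟨z₁, hz₁, hrz⟩ := exists_revC_zero hok hT h ht0 hzden hzlt hzlo hzhi hsg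
    clear hsg
    obtain ⟨hz₁0, hroot1⟩ := root_of_revC_zero hopen hreg hrz
    set Y1 : ℝ := z₁⁻¹ with hY1
    -- the far root is far: `|Y1| > 1/|z|max ≥ |Y_near|`
    have hzabs : |z₁| * fd.zden ≤ (zAbsMax fd : ℝ) := by
      have hzd : (0 : ℝ) < fd.zden := by exact_mod_cast hzden
      have hlo' : ((fd.zlo : ℤ) : ℝ) ≤ z₁ * fd.zden := by have := hz₁.1; rw [div_lt_iff₀ hzd] at this; linarith
      have hhi' : z₁ * fd.zden ≤ ((fd.zhi : ℤ) : ℝ) := by have := hz₁.2; rw [lt_div_iff₀ hzd] at this; linarith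
      rw [← abs_of_pos hzd, ← abs_mul, abs_le]
      have hm1 : ((fd.zlo.natAbs : ℕ) : ℝ) ≤ (zAbsMax fd : ℝ) := by exact_mod_cast le_max_left _ _
      have hm2 : ((fd.zhi.natAbs : ℕ) : ℝ) ≤ (zAbsMax fd : ℝ) := by exact_mod_cast le_max_right _ _
      rw [Nat.cast_natAbs, Int.cast_abs] at hm1 hm2
      constructor
      · linarith [neg_abs_le (fd.zlo : ℝ)]
      · linarith [le_abs_self (fd.zhi : ℝ)]
    have hfarsep : ∀ {rd : RootData} {Y : ℝ},
        |Y| * ((2 * D * T : ℕ) : ℝ) ≤ ((rd.cv.natAbs + absSum rd.av + rd.wv : ℕ) : ℝ) →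
        (rd.cv.natAbs + absSum rd.av + rd.wv) * zAbsMax fd < 2 * D * T * fd.zden → Y ≠ Y1 := by
      intro rd Y hloc hsep hYeq
      have hsep' : (((rd.cv.natAbs + absSum rd.av + rd.wv) * zAbsMax fd : ℕ) : ℝ) < ((2 * D * T * fd.zden : ℕ) : ℝ) := by
        exact_mod_cast hsep
      push_cast at hsep' hloc
      -- `|Y|·Q·|z₁|·zden ≤ M·zAbsMax < Q·zden` but `Y·z₁ = 1`
      have hYz : |Y| * |z₁| = 1 := by rw [hYeq, hY1, ← abs_mul, inv_mul_cancel₀ hz₁0, abs_one]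
      have hQpos : (0 : ℝ) < 2 * (D : ℝ) * T := by
        have := hQr; rw [hQn] at this; push_cast at this; exact this
      have hzdpos : (0 : ℝ) < fd.zden := by exact_mod_cast hzden
      have e : |Y| * (2 * (D : ℝ) * T) * (|z₁| * fd.zden) = 2 * (D : ℝ) * T * fd.zden := by
        calc |Y| * (2 * (D : ℝ) * T) * (|z₁| * fd.zden) = (|Y| * |z₁|) * (2 * (D : ℝ) * T * fd.zden) := by ring
          _ = _ := by rw [hYz, one_mul]
      have hM : (0 : ℝ) ≤ (rd.cv.natAbs : ℝ) + (absSum rd.av : ℝ) + (rd.wv : ℝ) := by positivity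
      have := mul_le_mul hloc hzabs (by positivity) hM
      rw [e] at this
      linarith
    have hne01 : Y0 ≠ Y1 := hfarsep hloc0 hsep0
    have hne21 : Y2 ≠ Y1 := hfarsep hloc2 hsep2
    -- values of the near points; `Y0 ≠ Y2` by the value separation
    set v0 := growthLogR (pR (aOfS t)) (qR (aOfS t)) (X0 + t 6) (Y0 + t 6) with hv0
    set v2 := growthLogR (pR (aOfS t)) (qR (aOfS t)) (X2 + t 6) (Y2 + t 6) with hv2
    have h02' : ((h0 : ℤ) : ℝ) < l2 := by exact_mod_cast h02
    have hv02 : v0 < v2 := lt_of_mul_lt_mul_right (by linarith : v0 * SC < v2 * SC) hSC.le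
    -- `x` is determined by `y` (P2 g23): the near points sit over roots of the cubic
    obtain ⟨hC0r, hP0, hQ0, hx0⟩ := isCritical_aOfS_root (s := t) (P := cubicP t) (Q := cubicQ t) (C := cubicC t)
      (fun _ => rfl) (fun _ => rfl) (fun _ => rfl) h6.2.ne hk0
    obtain ⟨hC2r, hP2, hQ2, hx2⟩ := isCritical_aOfS_root (s := t) (P := cubicP t) (Q := cubicQ t) (C := cubicC t)
      (fun _ => rfl) (fun _ => rfl) (fun _ => rfl) h6.2.ne hk2
    simp only [add_sub_cancel_right] at hC0r hP0 hQ0 hx0 hC2r hP2 hQ2 hx2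
    have hne02 : Y0 ≠ Y2 := by
      intro heq
      apply hv02.ne
      rw [hv0, hv2, hx0, hx2, heq]
    -- the image description of `critVals` and the root set of the cubic
    have himg := critVals_aOfS_eq_image (s := t) (P := cubicP t) (Q := cubicQ t) (C := cubicC t)
      (fun _ => rfl) (fun _ => rfl) (fun _ => rfl) h6.2.ne
    set V : ℝ → ℝ := fun Y => growthLogR (pR (aOfS t)) (qR (aOfS t))
      (t 6 - Y + (t 6 - t 0) * cubicP t Y / cubicQ t Y) (Y + t 6) with hV
    set Adm : Set ℝ := {Y | cubicC t Y = 0 ∧ cubicQ t Y ≠ 0 ∧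
      ∀ k, critFactors (pR (aOfS t)) (qR (aOfS t)) (t 6 - Y + (t 6 - t 0) * cubicP t Y / cubicQ t Y) (Y + t 6) k ≠ 0}
      with hAdm
    have himg' : critVals (aOfS t) = V '' Adm := himg
    -- the root set has at most three elements and contains the three distinct roots
    obtain ⟨hRfin, hRle⟩ := cubicFun_roots_finite (C := cubicC t) (fun Y => cubicC_eq_poly t Y)
      (Y₀ := t 1) (cubic_at_s1_neg (s := t) (C := cubicC t) (fun _ => rfl) hopen).ne
    have hsub3 : ({Y0, Y1, Y2} : Set ℝ) ⊆ {Y | cubicC t Y = 0} := by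
      intro Y hY
      simp only [Set.mem_insert_iff, Set.mem_singleton_iff] at hY
      rcases hY with rfl | rfl | rfl
      · exact hC0r
      · exact hroot1
      · exact hC2r
    have hthree : ({Y0, Y1, Y2} : Set ℝ).ncard = 3 :=
      Set.ncard_eq_three.mpr ⟨Y0, Y1, Y2, hne01, hne02, hne21.symm, rfl⟩
    have hRoots : {Y | cubicC t Y = 0} = {Y0, Y1, Y2} :=
      (Set.eq_of_subset_of_ncard_le hsub3 (by rw [hthree]; exact hRle) hRfin).symm
    have hAdmSub : Adm ⊆ {Y0, Y1, Y2} := fun Y hY => by rw [← hRoots]; exact hY.1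
    -- `Regular` ⇒ all three roots are admissible
    have hAdmfin : Adm.Finite := (Set.toFinite _).subset hAdmSub
    have hAdm3 : Adm = {Y0, Y1, Y2} := by
      apply Set.eq_of_subset_of_ncard_le hAdmSub _ (Set.toFinite _)
      rw [hthree]
      have : (critVals (aOfS t)).ncard = 3 := hreg
      rw [himg'] at this
      have := Set.ncard_image_le (f := V) hAdmfin
      omega
    have hY1adm : Y1 ∈ Adm := by rw [hAdm3]; simp
    obtain ⟨_, hQ1, hfac1⟩ := hY1adm
    -- the far value
    have hY10 : Y1 ≠ 0 := inv_ne_zero hz₁0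
    obtain ⟨hD1, hx1⟩ := x_eq_of_root t hY10 hQ1
    rw [hY1, inv_inv] at hD1 hx1
    -- the piece containing `z₁` and the value enclosure there
    obtain ⟨j, hj, η, hη, hzj⟩ := exists_piece hzden hzlt hpieces hz₁
    obtain ⟨G, hG, hGl, hGh⟩ := pieceOK_sound (List.all_eq_true.mp hall j (List.mem_range.mpr hj))
    rw [hl1] at hGl; rw [hh1v] at hGh
    have hv := valid_noise hok h (show |(0 : ℝ)| ≤ 1 by simp) hη
    set ε := noise D lo hi t 0 η with hε
    have htA := tAF_mem hok h ht0 (show |(0 : ℝ)| ≤ 1 by simp) hη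
    have hzmem : mem SC ε z₁ (zPieceAF fd j) := by
      have hQ' : 0 < 2 * fd.pieces * fd.zden := Nat.mul_pos (Nat.mul_pos (by norm_num) hpieces) hzden
      have := coordAF_mem hv (2 * (fd.pieces : ℤ) * fd.zlo + (2 * (j : ℤ) + 1) * (fd.zhi - fd.zlo))
        [0, 0, 0, 0, 0, 0, 0] (fd.zhi - fd.zlo).toNat hQ' 9 (Or.inr rfl)
      have e9 : ε 9 = η := by simp [hε, noise]
      rw [zPieceAF]
      convert this using 2
      rw [coordR, e9, hzj]
      simp [linR]
    obtain ⟨_, hnum1, hmem1⟩ := farValueAF_sound hv htA hzmem hG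
    -- `V Y1` is the far sum at `(X(z₁), z₁)`
    have hVY1 : V Y1 = farSum t (xNum t z₁ / xDen t z₁) z₁ := by
      have e1 : t 6 - Y1 + (t 6 - t 0) * cubicP t Y1 / cubicQ t Y1 = xNum t z₁ / xDen t z₁ + t 6 := by
        rw [hY1, ← hx1]; ring
      have e2 : Y1 + t 6 = z₁⁻¹ + t 6 := by rw [hY1]
      simp only [hV]
      rw [e1, e2, growthLogR_far t _ hz₁0 hnum1, farSum]
    have hl1 : ((l1 : ℤ) : ℝ) ≤ V Y1 * SC := by
      rw [hVY1]; exact le_trans (by exact_mod_cast hGl) (lo_le hv hmem1)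
    have hh1 : V Y1 * SC ≤ ((h1 : ℤ) : ℝ) := by
      rw [hVY1]; exact le_trans (le_hi hv hmem1) (by exact_mod_cast hGh)
    -- `V Y0 = v0`, `V Y2 = v2`
    have hVY0 : V Y0 = v0 := by simp only [hV, hv0, hx0]
    have hVY2 : V Y2 = v2 := by simp only [hV, hv2, hx2]
    -- the critical values are the three values
    have hcv : critVals (aOfS t) = {v0, V Y1, v2} := by
      rw [himg', hAdm3, Set.image_insert_eq, Set.image_insert_eq, Set.image_singleton, hVY0, hVY2]
    have h12' : ((h1 : ℤ) : ℝ) < l2 := by exact_mod_cast h12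
    have hv12 : V Y1 < v2 := lt_of_mul_lt_mul_right (by linarith : V Y1 * SC < v2 * SC) hSC.le
    obtain ⟨hsup, hsup'⟩ := sSup_three hv02 hv12
    have hC1eq : C1 (aOfS t) = v2 := by rw [C1, hcv, hsup]
    have hC0eq : C0 (aOfS t) = max v0 (V Y1) := by rw [C0, hC1eq, hcv, hsup']
    refine ⟨?_, ?_, ?_, ?_⟩
    · rw [hC1eq, le_div_iff₀ hden']
      have hc1 : ((h2 : ℤ) : ℝ) * den ≤ c1hi * SC := by exact_mod_cast hC1
      refine le_of_mul_le_mul_right ?_ hSC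
      calc v2 * den * SC = v2 * SC * den := by ring
        _ ≤ (h2 : ℝ) * den := mul_le_mul_of_nonneg_right hu2 hden'.le
        _ ≤ c1hi * SC := hc1
    · rw [hC0eq, div_le_iff₀ hden']
      have hc0 : (c0lo : ℝ) * SC ≤ l1 * den := by exact_mod_cast hC0lo
      have hmx := le_max_right v0 (V Y1)
      refine le_of_mul_le_mul_right ?_ hSC
      calc (c0lo : ℝ) * SC ≤ l1 * den := hc0
        _ ≤ V Y1 * SC * den := mul_le_mul_of_nonneg_right hl1 hden'.le
        _ ≤ max v0 (V Y1) * SC * den := by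
            have := mul_le_mul_of_nonneg_right (mul_le_mul_of_nonneg_right hmx hSC.le) hden'.le; linarith
        _ = max v0 (V Y1) * den * SC := by ring
    · rw [hC0eq, le_div_iff₀ hden']
      have hm : ((max h0 h1 : ℤ) : ℝ) * den ≤ c0hi * SC := by exact_mod_cast hC0hi
      have hm0 : ((h0 : ℤ) : ℝ) ≤ ((max h0 h1 : ℤ) : ℝ) := by exact_mod_cast le_max_left _ _
      have hm1 : ((h1 : ℤ) : ℝ) ≤ ((max h0 h1 : ℤ) : ℝ) := by exact_mod_cast le_max_right _ _
      refine le_of_mul_le_mul_right ?_ hSC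
      have hmax : max v0 (V Y1) * SC ≤ ((max h0 h1 : ℤ) : ℝ) := by
        rcases le_total v0 (V Y1) with hle | hle
        · rw [max_eq_right hle]; linarith
        · rw [max_eq_left hle]; linarith
      calc max v0 (V Y1) * den * SC = max v0 (V Y1) * SC * den := by ring
        _ ≤ ((max h0 h1 : ℤ) : ℝ) * den := mul_le_mul_of_nonneg_right hmax hden'.le
        _ ≤ c0hi * SC := hm
    · rw [hC0eq, hC1eq]
      exact max_lt hv02 hv12
  · exact absurd hc (by simp)

/-! ### Transfer to every direction of the box -/

section Transfer
variable {D T : ℕ} {lo hi : List ℕ} {r0 r2 : RootData} {fd : FarData} {c0lo c0hi c1hi : ℤ} {den : ℕ}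

/-- The box is an open-box box when the checker passes. -/
theorem boxOKc_of_critFarCheck (hc : critFarCheck D T lo hi r0 r2 fd c0lo c0hi c1hi den = true) :
    boxOKc D lo hi = true := by
  unfold critFarCheck at hc; split at hc
  · simp only [Bool.and_eq_true, decide_eq_true_eq] at hc; exact hc.1.1.1
  · exact absurd hc (by simp)

/-- **`critFarCheck = true` ⇒ for EVERY REGULAR direction `a` of the closed positive box whose normalised parameters
lie in the box: `C₁(a) ≤ s₀(a)·c₁⁺` and `s₀(a)·c₀⁻ ≤ C₀(a) ≤ s₀(a)·c₀⁺`.** -/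
theorem bounds_of_critFarCheck (hc : critFarCheck D T lo hi r0 r2 fd c0lo c0hi c1hi den = true) {a : Dir}
    (ha : BZBox a)
    (hbox : ∀ j : Fin 7, ((lo.getD j.succ 0 : ℕ) : ℝ) ≤ sParam a j.succ / sParam a 0 * D ∧
      sParam a j.succ / sParam a 0 * D ≤ ((hi.getD j.succ 0 : ℕ) : ℝ)) (hreg : Regular a) :
    C1 a ≤ sParam a 0 * ((c1hi : ℝ) / den) ∧ sParam a 0 * ((c0lo : ℝ) / den) ≤ C0 a ∧
      C0 a ≤ sParam a 0 * ((c0hi : ℝ) / den) := by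
  have hok := boxOKc_of_critFarCheck hc
  obtain ⟨hmem, ht0⟩ := normalise_mem_box hok ha hbox
  have hs0 : 0 < sParam a 0 := ha.1
  have hn := LemmaFBox.aOfS_normalise ha
  have eR : Regular a ↔ Regular (aOfS fun i => sParam a i / sParam a 0) := by
    conv_lhs => rw [hn]
    exact regular_smul hs0 _
  obtain ⟨hC1, hC0, hC0', _⟩ := bounds_aOfS_of_critFarCheck hc hmem ht0 (eR.1 hreg)
  have e1 : C1 a = sParam a 0 * C1 (aOfS fun i => sParam a i / sParam a 0) := by
    conv_lhs => rw [hn]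
    exact C1_smul hs0 _
  have e0 : C0 a = sParam a 0 * C0 (aOfS fun i => sParam a i / sParam a 0) := by
    conv_lhs => rw [hn]
    exact C0_smul hs0 _
  refine ⟨?_, ?_, ?_⟩
  · rw [e1]; exact mul_le_mul_of_nonneg_left hC1 hs0.le
  · rw [e0]; exact mul_le_mul_of_nonneg_left hC0 hs0.le
  · rw [e0]; exact mul_le_mul_of_nonneg_left hC0' hs0.le

/-- `C₁(a) ≤ s₀(a)·c₁⁺` for every regular direction of the box. -/
theorem C1_le_of_critFarCheck (hc : critFarCheck D T lo hi r0 r2 fd c0lo c0hi c1hi den = true) {a : Dir}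
    (ha : BZBox a)
    (hbox : ∀ j : Fin 7, ((lo.getD j.succ 0 : ℕ) : ℝ) ≤ sParam a j.succ / sParam a 0 * D ∧
      sParam a j.succ / sParam a 0 * D ≤ ((hi.getD j.succ 0 : ℕ) : ℝ)) (hreg : Regular a) :
    C1 a ≤ sParam a 0 * ((c1hi : ℝ) / den) :=
  (bounds_of_critFarCheck hc ha hbox hreg).1

/-- `s₀(a)·c₀⁻ ≤ C₀(a) ≤ s₀(a)·c₀⁺` for every regular direction of the box (two-sided: `C₀` does not blow up across
the stratum). -/
theorem C0_mem_of_critFarCheck (hc : critFarCheck D T lo hi r0 r2 fd c0lo c0hi c1hi den = true) {a : Dir}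
    (ha : BZBox a)
    (hbox : ∀ j : Fin 7, ((lo.getD j.succ 0 : ℕ) : ℝ) ≤ sParam a j.succ / sParam a 0 * D ∧
      sParam a j.succ / sParam a 0 * D ≤ ((hi.getD j.succ 0 : ℕ) : ℝ)) (hreg : Regular a) :
    sParam a 0 * ((c0lo : ℝ) / den) ≤ C0 a ∧ C0 a ≤ sParam a 0 * ((c0hi : ℝ) / den) :=
  (bounds_of_critFarCheck hc ha hbox hreg).2

end Transfer

end CritFar

end Summit.KontsevichZagierPeriods.Zeta5Search.Barrier.ConeGamma

end
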